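import Summits.Langlands.Langlands.Theorems.QuadraticWindowHostInducedRepGaloisOverK
import Summits.Langlands.Langlands.Theorems.QuadraticWindowHostInducedRepGaloisOverKBridge
import Literature.NumberTheory.Automorphic.AsaiSignCont
import HarnessLib

/-!
# Galois representations over the CM field, continuation-form currency — stub
# `stub_galoisOverK_cont` of line `one-transparent-pane` (wave 4)
(crux `Summit.Langlands.Langlands.Theses.QuadraticWindow.HostInducedRep`, item stmt-Langlands-10902)

The landed `stub_galoisOverK_cond` (`…GaloisOverKBridge.lean`) / `stub_galoisOverK_ess`
(`…GaloisOverK.lean`) turn a cuspidal `P` on `GL_N(𝔸_K)`, `K` CM, with a `C`-algebraic weakly regular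
infinity type, conjugate self-dual a.e. on Satake parameters and ODD, plus an algebraic Hecke character
`ψ`, into the semisimple `ℓ`-adic dictionary `r ↔ P ⊗ (ψ ∘ det)⁻¹`, conditional on Fakhruddin–Pilloni,
Thm. 9.10, and on strong multiplicity one in pairing form
(`JacquetShalika1981_isEssConjSelfDual_of_isConjSelfDualAE`).  There, oddness is the RAW
partial-Euler-product pole `HasAsaiSign (complexConj K) 1` (`AsaiSign.lean`).  Wave 4 of the line re-bases
the whole Asai-sign chain on the CONTINUATION form `HasAsaiSignCont` (`AsaiSignCont.lean`: the continued
partial Asai `L`-function has its simple pole at `s = 1`), the currency of Mok's dichotomy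
`Mok2014_partialAsaiL_continuation_pole_dichotomy`, so that no Ramanujan-strength holomorphy hypothesis
on raw Euler products is needed.  This file is the `_cont` variant of the Galois stub: the SAME statement
with `HasAsaiSign ↦ HasAsaiSignCont`, and with Fakhruddin–Pilloni, Thm. 9.10, taken as a hypothesis BY
BODY in its continuation rendering (the text of the named fact
`FakhruddinPilloni2021_galoisRep_of_weaklyRegular_oddCont`, δ-equal to it).

Proof.  The landed proofs use the sign hypothesis only to feed Thm. 9.10, so the argument is unchanged:
`r₀ := ρ_{P,ι}` (Thm. 9.10), `r_ψ :=` Weil's `ℓ`-adic character of `ψ`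
(`HeckeCharacter.IsAlgebraic.exists_lAdic`), `r₁ := r₀ ⊗ (det r_ψ)⁻¹`, `r :=` a continuous
semisimplification of `r₁` (`IrreducibleGL3CM.stub_continuousSemisimplification`).  The step
`r₀ ↦ r`, which does not mention Fakhruddin–Pilloni at all, is isolated here once and for all as
`exists_semisimple_untwist_of_frobCharpoly` (reusing the landed root/charpoly lemmas
`roots_arithFrobPolyOfSatake_map_mul_inv`, `charpoly_smul_eq_of_roots` of `…GaloisOverK.lean`); rank `0`
is done by hand as in `stub_galoisOverK_cond`.

References: N. Fakhruddin, V. Pilloni, J. Inst. Math. Jussieu 22 (2023), Thm. 9.10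
[FakhruddinPilloni2021]; A. Weil, Proc. Int. Symp. Tokyo–Nikko (1956), §2 [Weil1956]; H. Jacquet,
J. A. Shalika, Amer. J. Math. 103 (1981), Thm. 4.4 [JacquetShalikaAJM1981II]; C. P. Mok, Mem. AMS 235
(2015), Thm. 2.5.4 (a) [Mok2014].

LOG (worker A, wave 4, 2026-08-16).  Copy of the landed `stub_galoisOverK_cond` with the FP hypothesis
in Cont rendering (by body) and `HasAsaiSign ↦ HasAsaiSignCont`; the FP-free tail of the landed proof of
`stub_galoisOverK_ess` factored as `exists_semisimple_untwist_of_frobCharpoly`.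
-/

set_option linter.dupNamespace false -- project-wide option (lakefile weak.linter.dupNamespace); `Summit.Langlands.Langlands` is the mandated namespace

open scoped BigOperators Polynomial Classical NumberField Topology
open Filter Polynomial IsDedekindDomain NumberField
open Literature.NumberTheory Literature.NumberTheory.Automorphic
open Literature.NumberTheory.GaloisRepresentations

namespace Summit.Langlands.Langlands.Theorems.HostInducedRep.OneTransparentPane

open Summit.Langlands.Langlands.Theorems.TwistUnpackaging.KummerChebotarev (monic_arithFrobPolyOfSatake)

/-! ### The Fakhruddin–Pilloni-free step: untwisting by an algebraic Hecke character and semisimplifying -/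

/-- **Untwist and semisimplify.**  Let `K` be a number field, `P` an automorphic representation datum
of `GL_N(𝔸_K)`, `ψ` an ALGEBRAIC Hecke character of `K`, `ℓ` a prime, `ι : ℚ̄_ℓ ≃+* ℂ`, and
`r₀ : Γ_K → GL_N(ℚ̄_ℓ)` continuous, unramified with arithmetic-Frobenius characteristic polynomial
`arithFrobPolyOfSatake ι q_u N β` at every finite `u ∤ ℓ` where `P` has Satake parameter `β`.  Then there
is a continuous SEMISIMPLE `r : Γ_K → GL_N(ℚ̄_ℓ)` which, at every such `u` where moreover `ψ` is
unramified, is unramified with polynomial `arithFrobPolyOfSatake ι q_u N (β · ψ(ϖ_u)⁻¹)`.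
Proof: `r_ψ :=` Weil's `ℓ`-adic character of `ψ` (`HeckeCharacter.IsAlgebraic.exists_lAdic`:
`X - ι⁻¹(ψ(ϖ_u))⁻¹` at unramified `u ∤ ℓ`); `r₁ := r₀ ⊗ (det r_ψ)⁻¹` (`FramedRep.twist`) is unramified
where both are, and `charpoly r₁(σ) = charpoly (ι⁻¹(ψ(ϖ_u)) · r₀(σ))` is the monic polynomial whose
roots are `ι⁻¹(ψ(ϖ_u))` times those of `arithFrobPolyOfSatake ι q_u N β`, i.e.
`arithFrobPolyOfSatake ι q_u N (β · ψ(ϖ_u)⁻¹)` (`roots_arithFrobPolyOfSatake_map_mul_inv`,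
`charpoly_smul_eq_of_roots`); `r :=` a continuous semisimplification of `r₁`
(`IrreducibleGL3CM.stub_continuousSemisimplification`: same characteristic polynomials,
`r₁ g = 1 → r g = 1`). [cite: Weil1956, §2] -/
theorem exists_semisimple_untwist_of_frobCharpoly {N : ℕ} {K : Type} [Field K] [NumberField K]
    {hcpt : isCompact_glFiniteIntegralLevel N K} (P : CuspidalAutomorphicRepData N K hcpt)
    {ψ : HeckeCharacter K} (hψ : ψ.IsAlgebraic) {ℓ : ℕ} [Fact ℓ.Prime] (ι : PadicAlgCl ℓ ≃+* ℂ)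
    {r₀ : FramedGaloisRep K (PadicAlgCl ℓ) N}
    (hr₀ : ∀ (v : HeightOneSpectrum (𝓞 K)) (α : Multiset ℂ), P.1.HasSatakeParamAt v α →
      ((ℓ : ℕ) : 𝓞 K) ∉ v.asIdeal →
        r₀.IsUnramifiedAt v ∧ r₀.HasFrobCharpolyAt v (arithFrobPolyOfSatake ι v.residueCard N α)) :
    ∃ r : FramedGaloisRep K (PadicAlgCl ℓ) N, r.toGaloisRep.IsSemisimple ∧
      ∀ (u : HeightOneSpectrum (𝓞 K)) (β : Multiset ℂ), ((ℓ : ℕ) : 𝓞 K) ∉ u.asIdeal →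
        P.1.HasSatakeParamAt u β → ψ.IsUnramifiedAt u →
          r.IsUnramifiedAt u ∧
            r.HasFrobCharpolyAt u
              (arithFrobPolyOfSatake ι u.residueCard N (β.map (fun b ↦ b * (ψ.valueAtUniformizer u)⁻¹))) := by
  -- Weil's `ℓ`-adic character of `ψ`
  obtain ⟨rψ, hrψ⟩ := hψ.exists_lAdic ι
  -- the twisting character `χ' = (det r_ψ)⁻¹ : Γ_K →ₜ* ℚ̄_ℓˣ`
  obtain ⟨χ', hχ'⟩ : ∃ χ' : Field.absoluteGaloisGroup K →ₜ* (PadicAlgCl ℓ)ˣ,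
      ∀ g, χ' g = (Matrix.GeneralLinearGroup.det (rψ g))⁻¹ :=
    ⟨(FramedRep.det rψ)⁻¹, fun _ ↦ rfl⟩
  -- continuous semisimplification of the twist `r₀ ⊗ χ'`
  obtain ⟨r, hss, hcp, hker⟩ :=
    IrreducibleGL3CM.stub_continuousSemisimplification K ℓ N (r₀.twist χ')
  refine ⟨r, hss, fun u β hℓ hβ hψu ↦ ?_⟩
  obtain ⟨h₀unr, h₀frob⟩ := hr₀ u β hβ hℓ
  obtain ⟨hψunr, hψfrob⟩ := hrψ u hℓ hψu
  refine ⟨fun 𝔓 h𝔓 τ hτ ↦ hker τ ?_, fun 𝔓 h𝔓 σ hσ ↦ ?_⟩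
  · -- unramified: both factors die on inertia
    have h1 : r₀ τ = 1 := h₀unr 𝔓 h𝔓 τ hτ
    have h2 : rψ τ = 1 := hψunr 𝔓 h𝔓 τ hτ
    have h3 : χ' τ = 1 := by rw [hχ', h2, map_one, inv_one]
    rw [FramedRep.twist_apply_of_eq_one _ _ h3, h1]
  · -- Frobenius: `charpoly (ι⁻¹(ψ(ϖ_u)) · r₀(σ))` has the roots of the untwisted prediction
    rw [hcp]
    have hr₀σ : FramedRep.charpoly r₀ σ = arithFrobPolyOfSatake ι u.residueCard N β :=
      h₀frob 𝔓 h𝔓 σ hσ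
    have hrψσ := (FramedGaloisRep.hasFrobCharpolyAt_iff_of_rank_one rψ u _).mp hψfrob 𝔓 h𝔓 σ hσ
    have hχ'σ : ((χ' σ : (PadicAlgCl ℓ)ˣ) : PadicAlgCl ℓ) = ι.symm (ψ.valueAtUniformizer u) := by
      rw [hχ', Units.val_inv_eq_inv_val, Matrix.GeneralLinearGroup.val_det_apply,
        Matrix.det_fin_one, hrψσ, map_inv₀, inv_inv]
    have hk0 : ι.symm (ψ.valueAtUniformizer u) ≠ 0 := by
      rw [← hχ'σ]
      exact Units.ne_zero _
    unfold FramedRep.charpoly at hr₀σ ⊢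
    rw [FramedRep.coe_twist_apply, hχ'σ]
    exact charpoly_smul_eq_of_roots hr₀σ hk0 (monic_arithFrobPolyOfSatake ι _ N _)
      (roots_arithFrobPolyOfSatake_map_mul_inv ι _ N β _)

/-! ### The stub in the continuation-form currency -/

/-- **Stub `stub_galoisOverK_cont` of line `one-transparent-pane` (wave 4)**: the landed
`stub_galoisOverK_cond` with the Asai-sign hypothesis in CONTINUATION form and Fakhruddin–Pilloni,
Thm. 9.10, as a hypothesis by body in the same currency.  Hypotheses: (1) Fakhruddin–Pilloni, Thm. 9.10
(CM field, `χ = 1`), rendered with oddness `HasAsaiSignCont π c 1` — the body of the named fact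
`FakhruddinPilloni2021_galoisRep_of_weaklyRegular_oddCont`; (2) strong multiplicity one in pairing form
(`JacquetShalika1981_isEssConjSelfDual_of_isConjSelfDualAE`, Jacquet–Shalika 1981 (II), Thm. 4.4).
Conclusion: for `K` CM, `P` cuspidal on `GL_N(𝔸_K)` with a `C`-algebraic weakly regular infinity type,
conjugate self-dual a.e. on Satake parameters, whose CONTINUED Asai `L`-function `L^S(s, P, As^{(-1)^{N-1}})`
has its pole at `s = 1` (`HasAsaiSignCont (complexConj K) 1`), and `ψ` an algebraic Hecke character: for
every `ℓ`, `ι` a continuous SEMISIMPLE `r : Γ_K → GL_N(ℚ̄_ℓ)` which at every finite `u ∤ ℓ` where `P`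
has Satake parameter `β` and `ψ` is unramified is unramified with arithmetic-Frobenius characteristic
polynomial `arithFrobPolyOfSatake ι q_u N (β · ψ(ϖ_u)⁻¹)`.
Proof: rank `0` by hand (a Satake parameter in rank `0` is empty, `HasSatakeParamAt.card_eq`, and every
`0 × 0` characteristic polynomial is `1`); for `0 < N`, (2) gives `IsEssConjSelfDual P 1`, (1) gives
`r₀ = ρ_{P,ι}`, and `exists_semisimple_untwist_of_frobCharpoly` untwists by `ψ` and semisimplifies.
[cite: FakhruddinPilloni2021, Thm. 9.10] [cite: JacquetShalikaAJM1981II, Thm. 4.4] [cite: Weil1956, §2] -/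
theorem stub_galoisOverK_cont :
    (∀ (n : ℕ) (K : Type) [Field K] [NumberField K] [IsCMField K]
      (hcpt : isCompact_glFiniteIntegralLevel n K) (π : CuspidalAutomorphicRepData n K hcpt)
      (T : InfinityType K n), π.1.HasInfinityType T → T.IsCAlgebraic → T.IsWeaklyRegular →
        π.1.IsEssConjSelfDual 1 → π.1.HasAsaiSignCont (NumberField.IsCMField.complexConj K) 1 →
          ∀ (ℓ : ℕ) [Fact ℓ.Prime] (ι : PadicAlgCl ℓ ≃+* ℂ),
            ∃ r : GaloisRepresentations.FramedGaloisRep K (PadicAlgCl ℓ) n,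
              ∀ (v : HeightOneSpectrum (𝓞 K)) (α : Multiset ℂ), π.1.HasSatakeParamAt v α →
                ((ℓ : ℕ) : 𝓞 K) ∉ v.asIdeal →
                  r.IsUnramifiedAt v ∧
                    r.HasFrobCharpolyAt v (arithFrobPolyOfSatake ι v.residueCard n α)) →
    JacquetShalika1981_isEssConjSelfDual_of_isConjSelfDualAE →
    ∀ (N : ℕ) (K : Type) [Field K] [NumberField K] [IsCMField K]
      (hcpt : isCompact_glFiniteIntegralLevel N K) (P : CuspidalAutomorphicRepData N K hcpt)
      (T : InfinityType K N) (ψ : HeckeCharacter K),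
      P.1.HasInfinityType T → T.IsCAlgebraic → T.IsWeaklyRegular →
      P.1.IsConjSelfDualAE (NumberField.IsCMField.complexConj K) →
      P.1.HasAsaiSignCont (NumberField.IsCMField.complexConj K) 1 → ψ.IsAlgebraic →
    ∀ (ℓ : ℕ) [Fact ℓ.Prime] (ι : PadicAlgCl ℓ ≃+* ℂ),
      ∃ r : FramedGaloisRep K (PadicAlgCl ℓ) N, r.toGaloisRep.IsSemisimple ∧
        ∀ (u : HeightOneSpectrum (𝓞 K)) (β : Multiset ℂ), ((ℓ : ℕ) : 𝓞 K) ∉ u.asIdeal →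
          P.1.HasSatakeParamAt u β → ψ.IsUnramifiedAt u →
            r.IsUnramifiedAt u ∧
              r.HasFrobCharpolyAt u
                (arithFrobPolyOfSatake ι u.residueCard N (β.map (fun b ↦ b * (ψ.valueAtUniformizer u)⁻¹))) := by
  intro hFP hSMO N K _ _ _ hcpt P T ψ hT hC hW hcsd hodd hψ ℓ _ ι
  rcases Nat.eq_zero_or_pos N with rfl | hN
  · -- rank `0`: a (semisimple) rank-`0` representation; all `0 × 0` characteristic polynomials are `1`
    obtain ⟨r, hss, -, -⟩ := IrreducibleGL3CM.stub_continuousSemisimplification K ℓ 0 1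
    refine ⟨r, hss, fun u β _ hβ _ ↦ ⟨fun 𝔓 _ τ _ ↦ Subsingleton.elim _ _, fun 𝔓 _ σ _ ↦ ?_⟩⟩
    have hβ0 : β = 0 := Multiset.card_eq_zero.mp hβ.card_eq
    subst hβ0
    unfold FramedRep.charpoly arithFrobPolyOfSatake
    rw [Multiset.map_zero, Multiset.map_zero, Multiset.prod_zero, Matrix.charpoly,
      Matrix.det_isEmpty]
  · -- rank `≥ 1`: SMO gives the pairing form, F–P 9.10 (Cont) gives `r₀`, then untwist + semisimplify
    obtain ⟨r₀, hr₀⟩ := hFP N K hcpt P T hT hC hW (hSMO N K hcpt P hN hcsd) hodd ℓ ι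
    exact exists_semisimple_untwist_of_frobCharpoly P hψ ι hr₀

end Summit.Langlands.Langlands.Theorems.HostInducedRep.OneTransparentPane
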